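import Mathlib.Topology.Sequences
import Literature.NumberTheory.EllipticCurves.Sprung2017.TraceCoordinateFunctionalEquationProofs
import HarnessLib

/-!
# Sprung 2017, §3.4 (Prop. 3.14) for the α-free half-logarithm matrix at `(p, a_p) = (3, 3b)`:
# `ℒ(T) = M(T)·ℒ(T^ι)` with an INTEGRAL matrix `M ∈ M₂(ℤ_3⟦T⟧)` — proofs only

A *proofs* companion (theorems only; no definition, no named fact) of `HalfLogarithmMatrix`,
`HalfLogarithmMatrixLimit` (`ℒ = halfLogMatrix b = lim_n A_n`, `A_n = 𝒞_1⋯𝒞_n C^{−(n+2)}`) and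
`TraceCoordinateFunctionalEquationProofs`, `ι = T^ι = (1+T)⁻¹ − 1` (`invOnePlusSubOne`).

## What is proved

Sprung 2017, Prop. 3.14 ("All `𝒞̂_i(1+T)` are invariant under `1 + T ↦ 1/(1+T)`") says that the COMPLETED
log matrix is `ι`-invariant. For the NON-completed matrix `Log_{α,β} = ℒ·(−1 −1; β α)` the factors are only
invariant up to a ROW TWIST: with `Φ_{3^{m+1}}(1+T) = 1 + y + y²`, `y = (1+T)^{3^m}`, one has
`Φ_{3^{m+1}}(1+T^ι) = (1+T)^{−2·3^m}·Φ_{3^{m+1}}(1+T)` (`subst_invOnePlusSubOne_cyclotomicFactor`), i.e.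
`𝒞_{m+1}(T^ι) = diag(1, (1+T)^{−2·3^m})·𝒞_{m+1}(T)`. We prove that these twists are absorbed by an
INTEGRAL left multiplier:

* §2 `exists_twistMatrix_rowSeq` — for every `n` there is `M_n ∈ M₂(ℤ[T])` with
  `x_m = M_n · x_m(T^ι)` for the two columns `x_{n+1}, x_n` of `𝒞_1⋯𝒞_n = (u_{n+1} u_n; v_{n+1} v_n)`
  (any ring, any `a`; `M_0 = 1`, `M_{n+1} = E_{n+1}M_n` with the explicit unipotent-type factor
  `E_{n+1} = 1 + T((1+T)^{3^n}+1)·(x_n)(−v_{n+1}, u_{n+1})`, using `T·det(𝒞_1⋯𝒞_n) = ω_n = (1+T)^{3^n} − 1`,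
  `X_mul_det_rowSeq`);
* §3 `exists_twistMatrix_halfLogApprox` — hence `A_n = M_n·A_n(T^ι)` in `M₂(ℚ_3⟦T⟧)`;
* §4 **`exists_integral_halfLogMatrix_eq_mul_subst`** — passing to the coefficientwise `3`-adic limit along a
  subsequence on which the (integral!) coefficients of `M_n` converge (sequential compactness of
  `ℤ_3^ℕ`): there is `M ∈ M₂(ℤ_3⟦T⟧)` with `ℒ_{ik} = Σ_l ι(M_{il})·ℒ_{lk}(T^ι)`.

CONSUMER (Summits side, crux `SprungLowerDivisibilityAtThree`, line `chromatic-common-zeros`): with the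
PROVED trace-coordinate functional equation (`thm413_traceCoordinate_functionalEquation_three_holds`) this
gives the `ι`-STABILITY of the ideal `(L♯, L♭) ⊂ Λ` of an X8 Sprung pair, hence of its common-zero locus.
HONEST FRAMING: elementary algebra + a compactness argument about the tree's own definition `halfLogMatrix`;
special case `p = 3` of the structure behind Sprung 2017 Prop. 3.14 / Cor. 4.6; nothing about any curve;
BSD is not proved by any of this.
-- TODO(general form): any odd `p` (`Φ_{p^{m+1}}(1+T^ι) = (1+T)^{−φ(p^{m+1})}Φ_{p^{m+1}}(1+T)`, the factor
-- `((1+T)^{φ(p^{m+1})} − 1)/ω_m = Σ_{k<p−1} (1+T)^{k p^m}` replacing `(1+T)^{3^m} + 1`).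

## References
* F. Sprung, *On pairs of `p`-adic `L`-functions for weight-two modular forms*, Algebra & Number Theory 11
  (2017), §3.1 (the matrices `𝒞_i`, `Log_{α,β}`), §3.4 Prop. 3.14 (invariance of `𝒞̂_i`), Cor. 4.6
  (`(L̂♯, L̂♭) = (L♯, L♭)·Log·L̂og⁻¹`). [Sprung2017]
* R. Greenberg, LNM 1716 (1999), §1 (the involution `T ↦ (1+T)⁻¹ − 1` of `Λ`). [GreenbergLNM1716]
-/

noncomputable section

open scoped MatrixGroups

open Polynomial Filter Topology Literature.Barriers.BirchSwinnertonDyer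

namespace Literature.NumberTheory.EllipticCurves.Sprung2017

/-! ## §1 The cyclotomic factor under the involution -/

section Involution

variable {R : Type*} [CommRing R]

/-- `(1+T)·(1+ι) = 1` (private plumbing). [folklore] -/
private theorem one_add_X_mul_E :
    (1 + PowerSeries.X : PowerSeries R) * (invOnePlusSubOne + 1) = 1 :=
  one_add_X_mul_invOnePlusSubOne_add_one

/-- `((1+T)^k)(T^ι) = (1+ι)^k` (private plumbing). [folklore] -/
private theorem subst_one_add_X_pow (k : ℕ) :
    PowerSeries.subst (invOnePlusSubOne : PowerSeries R) ((1 + PowerSeries.X : PowerSeries R) ^ k) =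
      (invOnePlusSubOne + 1 : PowerSeries R) ^ k := by
  have hι := hasSubst_invOnePlusSubOne (R := R)
  rw [PowerSeries.subst_pow hι, PowerSeries.subst_add hι, PowerSeries.subst_X hι,
    ← PowerSeries.coe_substAlgHom hι, map_one, add_comm]

/-- **The row twist of `𝒞_{m+1}` under `ι`.** `Φ_{3^{m+1}}(1+T) = (1+T)^{2·3^m} + (1+T)^{3^m} + 1` satisfies
`Φ_{3^{m+1}}(1+T^ι) = (1+ι)^{2·3^m}·Φ_{3^{m+1}}(1+T)`, `1 + ι = (1+T)⁻¹` (the polynomial is palindromic in `1+T`).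
[cite: Sprung2017, §3.4 Prop. 3.14 (invariance of 𝒞̂_i under 1+T ↦ 1/(1+T))] -/
theorem subst_invOnePlusSubOne_cyclotomicFactor (m : ℕ) :
    PowerSeries.subst (invOnePlusSubOne : PowerSeries R)
        ((1 + PowerSeries.X : PowerSeries R) ^ (2 * 3 ^ m) + (1 + PowerSeries.X) ^ 3 ^ m + 1) =
      (invOnePlusSubOne + 1 : PowerSeries R) ^ (2 * 3 ^ m) *
        ((1 + PowerSeries.X : PowerSeries R) ^ (2 * 3 ^ m) + (1 + PowerSeries.X) ^ 3 ^ m + 1) := by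
  have hι := hasSubst_invOnePlusSubOne (R := R)
  rw [PowerSeries.subst_add hι, PowerSeries.subst_add hι, subst_one_add_X_pow, subst_one_add_X_pow,
    ← PowerSeries.coe_substAlgHom hι, map_one]
  set E : PowerSeries R := invOnePlusSubOne + 1 with hE
  set k : ℕ := 3 ^ m with hk
  have h1 : (1 + PowerSeries.X : PowerSeries R) ^ k * E ^ k = 1 := by
    rw [← mul_pow, one_add_X_mul_E, one_pow]
  have hexp : E ^ (2 * k) * ((1 + PowerSeries.X : PowerSeries R) ^ (2 * k) + (1 + PowerSeries.X) ^ k + 1) =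
      ((1 + PowerSeries.X : PowerSeries R) ^ k * E ^ k) ^ 2 +
        ((1 + PowerSeries.X : PowerSeries R) ^ k * E ^ k) * E ^ k + E ^ (2 * k) := by
    ring
  rw [hexp, h1]
  ring

end Involution

/-! ## §2 The twist matrices `M_n ∈ M₂(ℤ[T])` of the partial products `𝒞_1⋯𝒞_n` -/

section Twist

/-- `Φ_{3^{n+1}}(1+T) = (T+1)^{2·3^n} + (T+1)^{3^n} + 1` in `ℤ[T]`. [cite: Sprung2017, §3.1 (the entries of 𝒞_i)] -/
theorem cyclotomic_three_pow_succ_comp (n : ℕ) :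
    (cyclotomic (3 ^ (n + 1)) ℤ).comp (X + 1) = (X + 1) ^ (2 * 3 ^ n) + (X + 1) ^ 3 ^ n + 1 := by
  have h := cycloDelta_three_eq n
  rw [cycloDelta, sub_eq_iff_eq_add] at h
  rw [h]
  push_cast
  ring

/-- **`T·det(𝒞_1⋯𝒞_n) = ω_n`**: `T·(u_{n+1}v_n − u_n v_{n+1}) = (1+T)^{3^n} − 1` (`det 𝒞_m = Φ_{3^m}(1+T)` and
`T·Π_{m ≤ n} Φ_{3^m}(1+T) = (1+T)^{3^n} − 1`). [cite: Sprung2017, §3.1 and Cor. 4.4 (𝒞_1⋯𝒞_n = (u_{n+1} u_n; v_{n+1} v_n))] -/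
theorem X_mul_det_rowSeq (a : ℤ) (n : ℕ) :
    (X : ℤ[X]) * (sharpPoly a 3 (n + 1) * flatPoly a 3 n - sharpPoly a 3 n * flatPoly a 3 (n + 1)) =
      (X + 1) ^ 3 ^ n - 1 := by
  induction n with
  | zero => simp
  | succ n ih =>
    have hrec : sharpPoly a 3 (n + 1 + 1) * flatPoly a 3 (n + 1) - sharpPoly a 3 (n + 1) * flatPoly a 3 (n + 1 + 1) =
        (cyclotomic (3 ^ (n + 1)) ℤ).comp (X + 1) *
          (sharpPoly a 3 (n + 1) * flatPoly a 3 n - sharpPoly a 3 n * flatPoly a 3 (n + 1)) := by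
      rw [sharpPoly_add_two, flatPoly_add_two]
      ring
    calc (X : ℤ[X]) * (sharpPoly a 3 (n + 1 + 1) * flatPoly a 3 (n + 1) -
          sharpPoly a 3 (n + 1) * flatPoly a 3 (n + 1 + 1))
        = (cyclotomic (3 ^ (n + 1)) ℤ).comp (X + 1) *
            ((X : ℤ[X]) * (sharpPoly a 3 (n + 1) * flatPoly a 3 n - sharpPoly a 3 n * flatPoly a 3 (n + 1))) := by
          rw [hrec]; ring
      _ = ((X + 1) ^ (2 * 3 ^ n) + (X + 1) ^ 3 ^ n + 1) * ((X + 1) ^ 3 ^ n - 1) := by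
          rw [ih, cyclotomic_three_pow_succ_comp]
      _ = (X + 1) ^ 3 ^ (n + 1) - 1 := by
          rw [pow_succ 3 n, pow_mul (X + 1 : ℤ[X]) (3 ^ n) 3, mul_comm 2 (3 ^ n),
            pow_mul (X + 1 : ℤ[X]) (3 ^ n) 2]
          set y : ℤ[X] := (X + 1) ^ 3 ^ n with hy
          ring

variable {S : Type*} [CommRing S] (ψ : ℤ[X] →+* S) (σ : S →+* S) (a : ℤ)

/-- **The twist matrices.** For ring maps `ψ : ℤ[T] → S`, `σ : S → S` with `σ(ψ(a)) = ψ(a)` and, for every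
`m`, `σ(ψ Φ_{3^{m+1}}(1+T)) = w_m·ψ Φ_{3^{m+1}}(1+T)` with `ψ((1+T)^{2·3^m})·w_m = 1` (the row twist of
`𝒞_{m+1}`): for every `n` there is `M_n ∈ M₂(ℤ[T])` such that BOTH columns `x_m = (u_m, v_m)` (`m = n+1, n`) of
`𝒞_1⋯𝒞_n` satisfy `ψ(x_m) = ψ(M_n)·σ(ψ(x_m))`. Induction: `M_0 = 1`; `M_{n+1} = E_{n+1}·M_n` with
`E_{n+1} = 1 + T((1+T)^{3^n}+1)·x_n·(−v_{n+1}, u_{n+1})`, which fixes `x_{n+1}` and multiplies `x_n` by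
`1 + ((1+T)^{3^n}+1)·ω_n = (1+T)^{2·3^n}` (`X_mul_det_rowSeq`), cancelling the twist `w_n`.
[cite: Sprung2017, §3.4 Prop. 3.14 and §3.1] -/
theorem exists_twistMatrix_rowSeq (hC : σ (ψ (C a)) = ψ (C a))
    (hΦ : ∀ m : ℕ, ∃ w : S, σ (ψ ((cyclotomic (3 ^ (m + 1)) ℤ).comp (X + 1))) =
        w * ψ ((cyclotomic (3 ^ (m + 1)) ℤ).comp (X + 1)) ∧ ψ ((X + 1) ^ (2 * 3 ^ m)) * w = 1)
    (n : ℕ) :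
    ∃ M : Matrix (Fin 2) (Fin 2) ℤ[X], ∀ m : ℕ, (m = n + 1 ∨ m = n) → ∀ i : Fin 2,
      ψ (rowSeq a 3 i m) = ψ (M i 0) * σ (ψ (rowSeq a 3 0 m)) + ψ (M i 1) * σ (ψ (rowSeq a 3 1 m)) := by
  induction n with
  | zero =>
    refine ⟨1, fun m hm i => ?_⟩
    rcases hm with rfl | rfl <;> fin_cases i <;> simp [rowSeq, Matrix.one_apply]
  | succ n ih =>
    obtain ⟨M, hM⟩ := ih
    -- the factor `E_{n+1}`, `g = (1+T)^{3^n} + 1`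
    set E : Matrix (Fin 2) (Fin 2) ℤ[X] :=
      !![1 - X * ((X + 1) ^ 3 ^ n + 1) * sharpPoly a 3 n * flatPoly a 3 (n + 1),
          X * ((X + 1) ^ 3 ^ n + 1) * sharpPoly a 3 n * sharpPoly a 3 (n + 1);
        -(X * ((X + 1) ^ 3 ^ n + 1) * flatPoly a 3 n * flatPoly a 3 (n + 1)),
          1 + X * ((X + 1) ^ 3 ^ n + 1) * flatPoly a 3 n * sharpPoly a 3 (n + 1)] with hEdef
    have hE00 : E 0 0 = 1 - X * ((X + 1) ^ 3 ^ n + 1) * sharpPoly a 3 n * flatPoly a 3 (n + 1) := rfl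
    have hE01 : E 0 1 = X * ((X + 1) ^ 3 ^ n + 1) * sharpPoly a 3 n * sharpPoly a 3 (n + 1) := rfl
    have hE10 : E 1 0 = -(X * ((X + 1) ^ 3 ^ n + 1) * flatPoly a 3 n * flatPoly a 3 (n + 1)) := rfl
    have hE11 : E 1 1 = 1 + X * ((X + 1) ^ 3 ^ n + 1) * flatPoly a 3 n * sharpPoly a 3 (n + 1) := rfl
    have hdet := X_mul_det_rowSeq a n
    -- `E` fixes the column `x_{n+1}` …
    have hP1 : ∀ i : Fin 2, E i 0 * sharpPoly a 3 (n + 1) + E i 1 * flatPoly a 3 (n + 1) = rowSeq a 3 i (n + 1) := by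
      intro i
      fin_cases i
      · simp only [Fin.zero_eta, Fin.isValue, hE00, hE01, rowSeq_zero]
        ring
      · simp only [Fin.mk_one, Fin.isValue, hE10, hE11, rowSeq_one]
        ring
    -- … and multiplies the column `x_n` by `(1+T)^{2·3^n}`
    have hP2 : ∀ i : Fin 2, E i 0 * sharpPoly a 3 n + E i 1 * flatPoly a 3 n =
        (X + 1) ^ (2 * 3 ^ n) * rowSeq a 3 i n := by
      intro i
      fin_cases i
      · simp only [Fin.zero_eta, Fin.isValue, hE00, hE01, rowSeq_zero]
        linear_combination (((X + 1) ^ 3 ^ n + 1) * sharpPoly a 3 n) * hdet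
      · simp only [Fin.mk_one, Fin.isValue, hE10, hE11, rowSeq_one]
        linear_combination (((X + 1) ^ 3 ^ n + 1) * flatPoly a 3 n) * hdet
    -- the identities of the induction hypothesis, both old columns, read on `u` and `v`
    have hU1 := hM (n + 1) (Or.inl rfl) 0
    have hV1 := hM (n + 1) (Or.inl rfl) 1
    have hU0 := hM n (Or.inr rfl) 0
    have hV0 := hM n (Or.inr rfl) 1
    simp only [rowSeq_zero, rowSeq_one] at hU1 hV1 hU0 hV0
    refine ⟨E * M, fun m hm i => ?_⟩
    have hEM : ∀ l : Fin 2, (E * M) i l = E i 0 * M 0 l + E i 1 * M 1 l := fun l => by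
      rw [Matrix.mul_apply, Fin.sum_univ_two]
    have hP1i := congrArg ψ (hP1 i)
    have hP2i := congrArg ψ (hP2 i)
    simp only [map_add, map_mul] at hP1i hP2i
    rw [rowSeq_zero, rowSeq_one, hEM 0, hEM 1]
    simp only [map_add, map_mul]
    rcases hm with rfl | rfl
    · -- the NEW column `x_{n+2} = a·x_{n+1} − Φ·x_n`
      obtain ⟨w, hw, hw1⟩ := hΦ n
      have hrow : rowSeq a 3 i (n + 1 + 1) =
          C a * rowSeq a 3 i (n + 1) - (cyclotomic (3 ^ (n + 1)) ℤ).comp (X + 1) * rowSeq a 3 i n := by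
        fin_cases i
        · exact sharpPoly_add_two a 3 n
        · exact flatPoly_add_two a 3 n
      rw [hrow, sharpPoly_add_two, flatPoly_add_two]
      simp only [map_sub, map_mul, hC, hw]
      linear_combination (ψ (C a) * ψ (E i 0)) * hU1 + (ψ (C a) * ψ (E i 1)) * hV1 +
        (-(w * ψ ((cyclotomic (3 ^ (n + 1)) ℤ).comp (X + 1)) * ψ (E i 0))) * hU0 +
        (-(w * ψ ((cyclotomic (3 ^ (n + 1)) ℤ).comp (X + 1)) * ψ (E i 1))) * hV0 +
        (-ψ (C a)) * hP1i + (w * ψ ((cyclotomic (3 ^ (n + 1)) ℤ).comp (X + 1))) * hP2i +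
        (ψ ((cyclotomic (3 ^ (n + 1)) ℤ).comp (X + 1)) * ψ (rowSeq a 3 i n)) * hw1
    · -- the column `x_{n+1}` is fixed by `E`
      linear_combination ψ (E i 0) * hU1 + ψ (E i 1) * hV1 + (-1 : S) * hP1i

end Twist

/-! ## §3 The approximants: `A_n = M_n·A_n(T^ι)` in `M₂(ℚ_3⟦T⟧)` -/

section Approximants

/-- An integer polynomial read in `ℚ_3⟦T⟧` through `Λ` is its image through `ℚ` (private plumbing). [folklore] -/
private theorem coe_map_map_eq (q : ℤ[X]) :
    (((q.map (Int.castRingHom ℚ)).map (algebraMap ℚ ℚ_[3]) : ℚ_[3][X]) : PowerSeries ℚ_[3]) =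
      (iwasawaToPowerSeries 3).comp (toIwasawa 3) q := by
  rw [RingHom.comp_apply]
  change _ = PowerSeries.map (algebraMap ℤ_[3] ℚ_[3])
    (((q.map (Int.castRingHom ℤ_[3])) : ℤ_[3][X]) : PowerSeries ℤ_[3])
  rw [← Polynomial.polynomial_map_coe, Polynomial.map_map, Polynomial.map_map,
    RingHom.ext_int ((algebraMap ℤ_[3] ℚ_[3]).comp (Int.castRingHom ℤ_[3]))
      ((algebraMap ℚ ℚ_[3]).comp (Int.castRingHom ℚ))]

/-- The image of `T + 1` (private plumbing). [folklore] -/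
private theorem psi_X_add_one :
    (iwasawaToPowerSeries 3).comp (toIwasawa 3) (X + 1) = PowerSeries.X + 1 := by
  rw [← coe_map_map_eq]
  simp

/-- The image of a constant (private plumbing). [folklore] -/
private theorem psi_C (c : ℤ) :
    (iwasawaToPowerSeries 3).comp (toIwasawa 3) (C c) = PowerSeries.C (c : ℚ_[3]) := by
  rw [← coe_map_map_eq, Polynomial.map_C, Polynomial.map_C, Polynomial.coe_C, eq_intCast, eq_ratCast,
    Rat.cast_intCast]

variable (b : ℤ)

/-- The entries of `A_n` read in `ℚ_3⟦T⟧`: `(A_n)_{ik} = x^{(i)}_{n+1}·(C^{−(n+2)})_{0k} + x^{(i)}_n·(C^{−(n+2)})_{1k}`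
(private plumbing). [cite: Sprung2017, §3.1 (the partial products)] -/
private theorem coe_map_halfLogApprox_eq (n : ℕ) (i k : Fin 2) :
    (((halfLogApprox 3 (3 * b) n i k).map (algebraMap ℚ ℚ_[3]) : ℚ_[3][X]) : PowerSeries ℚ_[3]) =
      (iwasawaToPowerSeries 3).comp (toIwasawa 3) (rowSeq (3 * b) 3 i (n + 1)) *
          PowerSeries.C ((((sprungCinv 3 (3 * b)) ^ (n + 2)) 0 k : ℚ) : ℚ_[3]) +
        (iwasawaToPowerSeries 3).comp (toIwasawa 3) (rowSeq (3 * b) 3 i n) *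
          PowerSeries.C ((((sprungCinv 3 (3 * b)) ^ (n + 2)) 1 k : ℚ) : ℚ_[3]) := by
  simp only [halfLogApprox, Polynomial.map_add, Polynomial.map_mul, Polynomial.map_C, Polynomial.coe_add,
    Polynomial.coe_mul, Polynomial.coe_C, coe_map_map_eq, eq_ratCast]

/-- **`A_n = M_n · A_n(T^ι)`** with the integer twist matrix `M_n` of `exists_twistMatrix_rowSeq`
(constants are fixed by the substitution). [cite: Sprung2017, §3.4 Prop. 3.14 and §3.1] -/
theorem exists_twistMatrix_halfLogApprox (n : ℕ) :
    ∃ M : Matrix (Fin 2) (Fin 2) ℤ[X], ∀ i k : Fin 2,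
      (((halfLogApprox 3 (3 * b) n i k).map (algebraMap ℚ ℚ_[3]) : ℚ_[3][X]) : PowerSeries ℚ_[3]) =
        iwasawaToPowerSeries 3 (toIwasawa 3 (M i 0)) *
            PowerSeries.subst (invOnePlusSubOne : PowerSeries ℚ_[3])
              (((halfLogApprox 3 (3 * b) n 0 k).map (algebraMap ℚ ℚ_[3]) : ℚ_[3][X]) : PowerSeries ℚ_[3]) +
          iwasawaToPowerSeries 3 (toIwasawa 3 (M i 1)) *
            PowerSeries.subst (invOnePlusSubOne : PowerSeries ℚ_[3])
              (((halfLogApprox 3 (3 * b) n 1 k).map (algebraMap ℚ ℚ_[3]) : ℚ_[3][X]) : PowerSeries ℚ_[3]) := by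
  have hι := hasSubst_invOnePlusSubOne (R := ℚ_[3])
  set ψ : ℤ[X] →+* PowerSeries ℚ_[3] := (iwasawaToPowerSeries 3).comp (toIwasawa 3) with hψ
  set σ : PowerSeries ℚ_[3] →+* PowerSeries ℚ_[3] := (PowerSeries.substAlgHom hι).toRingHom with hσ
  have hσapp : ∀ x : PowerSeries ℚ_[3], σ x = PowerSeries.subst (invOnePlusSubOne : PowerSeries ℚ_[3]) x :=
    fun x => by rw [hσ, AlgHom.toRingHom_eq_coe, RingHom.coe_coe, PowerSeries.coe_substAlgHom]
  -- the two hypotheses of `exists_twistMatrix_rowSeq`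
  have hC : σ (ψ (C (3 * b))) = ψ (C (3 * b)) := by
    rw [hψ, psi_C, PowerSeries.C_eq_algebraMap, hσ, AlgHom.toRingHom_eq_coe, RingHom.coe_coe, AlgHom.commutes]
  have hΦ : ∀ m : ℕ, ∃ w : PowerSeries ℚ_[3], σ (ψ ((cyclotomic (3 ^ (m + 1)) ℤ).comp (X + 1))) =
      w * ψ ((cyclotomic (3 ^ (m + 1)) ℤ).comp (X + 1)) ∧ ψ ((X + 1) ^ (2 * 3 ^ m)) * w = 1 := by
    intro m
    refine ⟨(invOnePlusSubOne + 1 : PowerSeries ℚ_[3]) ^ (2 * 3 ^ m), ?_, ?_⟩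
    · have hq : ψ ((cyclotomic (3 ^ (m + 1)) ℤ).comp (X + 1)) =
          (1 + PowerSeries.X : PowerSeries ℚ_[3]) ^ (2 * 3 ^ m) + (1 + PowerSeries.X) ^ 3 ^ m + 1 := by
        rw [cyclotomic_three_pow_succ_comp, map_add, map_add, map_pow, map_pow, map_one, hψ, psi_X_add_one,
          add_comm PowerSeries.X 1]
      rw [hq, hσapp, subst_invOnePlusSubOne_cyclotomicFactor]
    · rw [map_pow, hψ, psi_X_add_one, add_comm PowerSeries.X 1, ← mul_pow, one_add_X_mul_E, one_pow]
  obtain ⟨M, hM⟩ := exists_twistMatrix_rowSeq ψ σ (3 * b) hC hΦ n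
  refine ⟨M, fun i k => ?_⟩
  have e1 := hM (n + 1) (Or.inl rfl) i
  have e0 := hM n (Or.inr rfl) i
  rw [coe_map_halfLogApprox_eq, coe_map_halfLogApprox_eq, coe_map_halfLogApprox_eq, ← hψ, ← hσapp, ← hσapp]
  simp only [map_add, map_mul]
  have hc0 : σ (PowerSeries.C ((((sprungCinv 3 (3 * b)) ^ (n + 2)) 0 k : ℚ) : ℚ_[3])) =
      PowerSeries.C ((((sprungCinv 3 (3 * b)) ^ (n + 2)) 0 k : ℚ) : ℚ_[3]) := by
    rw [PowerSeries.C_eq_algebraMap, hσ, AlgHom.toRingHom_eq_coe, RingHom.coe_coe, AlgHom.commutes]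
  have hc1 : σ (PowerSeries.C ((((sprungCinv 3 (3 * b)) ^ (n + 2)) 1 k : ℚ) : ℚ_[3])) =
      PowerSeries.C ((((sprungCinv 3 (3 * b)) ^ (n + 2)) 1 k : ℚ) : ℚ_[3]) := by
    rw [PowerSeries.C_eq_algebraMap, hσ, AlgHom.toRingHom_eq_coe, RingHom.coe_coe, AlgHom.commutes]
  rw [hc0, hc1]
  linear_combination (PowerSeries.C ((((sprungCinv 3 (3 * b)) ^ (n + 2)) 0 k : ℚ) : ℚ_[3])) * e1 +
    (PowerSeries.C ((((sprungCinv 3 (3 * b)) ^ (n + 2)) 1 k : ℚ) : ℚ_[3])) * e0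

end Approximants

/-! ## §4 The limit: `ℒ = M·ℒ(T^ι)` with `M ∈ M₂(ℤ_3⟦T⟧)` -/

section Limit

/-- `[T^e] G(ι) = Σ_{d ≤ e} [T^d]G · [T^e]ι^d` (`ι(0) = 0`): each coefficient of `G(T^ι)` is a FINITE linear form in
the coefficients of `G` (private plumbing). [folklore] -/
private theorem coeff_subst_invOnePlusSubOne_eq_sum (G : PowerSeries ℚ_[3]) (e : ℕ) :
    PowerSeries.coeff e (PowerSeries.subst (invOnePlusSubOne : PowerSeries ℚ_[3]) G) =
      ∑ d ∈ Finset.range (e + 1), PowerSeries.coeff d G *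
        PowerSeries.coeff e ((invOnePlusSubOne : PowerSeries ℚ_[3]) ^ d) := by
  have h0 : PowerSeries.constantCoeff (invOnePlusSubOne : PowerSeries ℚ_[3]) = 0 := constantCoeff_invOnePlusSubOne
  rw [PowerSeries.coeff_subst' (PowerSeries.HasSubst.of_constantCoeff_zero' h0),
    finsum_eq_sum_of_support_subset _ (s := Finset.range (e + 1)) ?_]
  · simp only [smul_eq_mul]
  · intro d hd
    simp only [Function.mem_support, ne_eq, Finset.coe_range, Set.mem_Iio] at hd ⊢
    by_contra hlt
    apply hd
    rw [PowerSeries.coeff_of_lt_order e (lt_of_lt_of_le (by exact_mod_cast (by omega : e < d))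
      (natCast_le_order_pow h0 d)), smul_zero]

/-- **Sprung 2017 Prop. 3.14 for the α-free half-logarithm matrix, INTEGRAL FORM: `ℒ(T) = M(T)·ℒ(T^ι)` with
`M ∈ M₂(ℤ_3⟦T⟧)`.** For `ℒ = halfLogMatrix b` (`a_3 = 3b`) there is a matrix `M` with entries in `Λ = ℤ_3⟦T⟧` such
that `ℒ_{ik} = ι(M_{i0})·ℒ_{0k}(T^ι) + ι(M_{i1})·ℒ_{1k}(T^ι)` in `ℚ_3⟦T⟧`. Proof: the approximants satisfy
`A_n = M_n·A_n(T^ι)` with `M_n ∈ M₂(ℤ[T])` (`exists_twistMatrix_halfLogApprox`); along a subsequence the integer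
coefficients of the `M_n` converge `3`-adically (sequential compactness of `(ℤ_3^ℕ)^{2×2}`), the coefficients of
`A_n` converge to those of `ℒ` (`tendsto_coeffSeq`), and every coefficient of `M_n·A_n(T^ι)` is a finite polynomial
in these. (In print: the completed `L̂og` is `ι`-INVARIANT, Prop. 3.14; the present `M` is the integral transition
matrix `Log·Log(T^ι)⁻¹` of the non-completed matrix, cf. Cor. 4.6.)
[cite: Sprung2017, §3.4 Prop. 3.14, Cor. 4.6 and §3.1 Lemma 3.3] [cite: GreenbergLNM1716, §1] -/
theorem exists_integral_halfLogMatrix_eq_mul_subst (b : ℤ) :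
    ∃ M : Matrix (Fin 2) (Fin 2) (PowerSeries ℤ_[3]), ∀ i k : Fin 2,
      halfLogMatrix b i k =
        iwasawaToPowerSeries 3 (M i 0) *
            PowerSeries.subst (invOnePlusSubOne : PowerSeries ℚ_[3]) (halfLogMatrix b 0 k) +
          iwasawaToPowerSeries 3 (M i 1) *
            PowerSeries.subst (invOnePlusSubOne : PowerSeries ℚ_[3]) (halfLogMatrix b 1 k) := by
  classical
  choose Mn hMn using exists_twistMatrix_halfLogApprox b
  -- the integer coefficients of the `M_n`, in the compact space `(ℤ_3^ℕ)^{2×2}`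
  let s : ℕ → (Fin 2 → Fin 2 → ℕ → ℤ_[3]) := fun n i l j => (((Mn n i l).coeff j : ℤ) : ℤ_[3])
  obtain ⟨a, φ, hφ, ha⟩ := SeqCompactSpace.tendsto_subseq s
  have ha' : ∀ (i l : Fin 2) (j : ℕ),
      Tendsto (fun n => (((Mn (φ n) i l).coeff j : ℤ) : ℚ_[3])) atTop (𝓝 ((a i l j : ℤ_[3]) : ℚ_[3])) := by
    intro i l j
    have h3 : Tendsto (fun n => s (φ n) i l j) atTop (𝓝 (a i l j)) :=
      tendsto_pi_nhds.mp (tendsto_pi_nhds.mp (tendsto_pi_nhds.mp ha i) l) j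
    have h4 := (continuous_subtype_val.tendsto (a i l j)).comp h3
    refine h4.congr fun n => ?_
    simp [s, Function.comp]
  refine ⟨fun i l => PowerSeries.mk (a i l), fun i k => ?_⟩
  ext j
  -- the `j`-th coefficient of `F·G(T^ι)` as a finite polynomial in the coefficients of `F` and `G`
  let T : (ℕ → ℚ_[3]) → (ℕ → ℚ_[3]) → ℚ_[3] := fun f g =>
    ∑ x ∈ Finset.HasAntidiagonal.antidiagonal j, f x.1 *
      ∑ d ∈ Finset.range (x.2 + 1), g d * PowerSeries.coeff x.2 ((invOnePlusSubOne : PowerSeries ℚ_[3]) ^ d)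
  have hT : ∀ F G : PowerSeries ℚ_[3],
      PowerSeries.coeff j (F * PowerSeries.subst (invOnePlusSubOne : PowerSeries ℚ_[3]) G) =
        T (fun d => PowerSeries.coeff d F) (fun d => PowerSeries.coeff d G) := by
    intro F G
    simp only [T, PowerSeries.coeff_mul, coeff_subst_invOnePlusSubOne_eq_sum]
  have hTlim : ∀ {f g : ℕ → ℕ → ℚ_[3]} {f₀ g₀ : ℕ → ℚ_[3]},
      (∀ d, Tendsto (fun n => f n d) atTop (𝓝 (f₀ d))) → (∀ d, Tendsto (fun n => g n d) atTop (𝓝 (g₀ d))) →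
        Tendsto (fun n => T (f n) (g n)) atTop (𝓝 (T f₀ g₀)) := by
    intro f g f₀ g₀ hf hg
    exact tendsto_finsetSum _ fun x _ =>
      (hf x.1).mul (tendsto_finsetSum _ fun d _ => (hg d).mul_const _)
  -- coefficients of the pieces
  have hcM : ∀ (n : ℕ) (i l : Fin 2) (d : ℕ),
      PowerSeries.coeff d (iwasawaToPowerSeries 3 (toIwasawa 3 (Mn n i l))) = (((Mn n i l).coeff d : ℤ) : ℚ_[3]) := by
    intro n i l d
    change PowerSeries.coeff d (PowerSeries.map (algebraMap ℤ_[3] ℚ_[3])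
      ((((Mn n i l).map (Int.castRingHom ℤ_[3])) : ℤ_[3][X]) : PowerSeries ℤ_[3])) = _
    rw [PowerSeries.coeff_map, Polynomial.coeff_coe, Polynomial.coeff_map]
    simp
  have hcMlim : ∀ (i l : Fin 2) (d : ℕ),
      PowerSeries.coeff d (iwasawaToPowerSeries 3 (PowerSeries.mk (a i l))) = ((a i l d : ℤ_[3]) : ℚ_[3]) := by
    intro i l d
    rw [PowerSeries.coeff_map, PowerSeries.coeff_mk]
    rfl
  -- along `φ`, the `j`-th coefficient of `(A_n)_{ik}` tends to that of `ℒ_{ik}` …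
  have hlhs : Tendsto (fun n => coeffSeq b (φ n) i k j) atTop (𝓝 (PowerSeries.coeff j (halfLogMatrix b i k))) :=
    (tendsto_coeffSeq b i k j).comp hφ.tendsto_atTop
  -- … and, being the `j`-th coefficient of `M_n·A_n(T^ι)`, also to that of `M·ℒ(T^ι)`
  have heq : ∀ n : ℕ, coeffSeq b (φ n) i k j =
      T (fun d => (((Mn (φ n) i 0).coeff d : ℤ) : ℚ_[3])) (fun d => coeffSeq b (φ n) 0 k d) +
        T (fun d => (((Mn (φ n) i 1).coeff d : ℤ) : ℚ_[3])) (fun d => coeffSeq b (φ n) 1 k d) := by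
    intro n
    have h := congrArg (PowerSeries.coeff j) (hMn (φ n) i k)
    rw [coeff_coe_map_halfLogApprox, map_add, hT, hT] at h
    simp only [hcM, coeff_coe_map_halfLogApprox] at h
    exact h
  have hrhs : Tendsto (fun n => coeffSeq b (φ n) i k j) atTop
      (𝓝 (T (fun d => ((a i 0 d : ℤ_[3]) : ℚ_[3])) (fun d => PowerSeries.coeff d (halfLogMatrix b 0 k)) +
        T (fun d => ((a i 1 d : ℤ_[3]) : ℚ_[3])) (fun d => PowerSeries.coeff d (halfLogMatrix b 1 k)))) := by
    simp_rw [heq]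
    exact (hTlim (ha' i 0) fun d => (tendsto_coeffSeq b 0 k d).comp hφ.tendsto_atTop).add
      (hTlim (ha' i 1) fun d => (tendsto_coeffSeq b 1 k d).comp hφ.tendsto_atTop)
  have hlim := tendsto_nhds_unique hlhs hrhs
  rw [hlim, map_add, hT, hT]
  simp only [hcMlim]

end Limit

end Literature.NumberTheory.EllipticCurves.Sprung2017

end
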